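import Summits.QuantumFields.YangMills.Theorems.UnitScaleTiltProp7ClosedFibreInteriorOfRouteAlpha
import Summits.QuantumFields.YangMills.Theorems.UnitScaleTiltProp7CovOfThm2Sockets
import HarnessLib

/-!
# Route `UnitScaleTilt`, crux K1 child «MinimiserStabilityRegPr» (stmt-QuantumFields-19200), skeleton v10 stub EX — **THE (β′) ↔ (α) ↔ COV TRIANGLE CLOSED IN
# THE TREE BY NAME: INTERIOR-AT-R ⇐ `landed_prop8` ∧ C-min ∧ [Balaban1985RegularSpaces] THEOREM 2 at the lit-balaban consumer interface `B8Thm2TorusAt.Thm2TorusAt`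
# (`G = SU(2)`, no regularity rider) at the T³ members — and at print's uniform form, and at the supplier's socket bundle** (w4's `interiorAtR_of_prop8_Cmin_cov`,
# p594954, ∘ w1's `cov_of_thm2TorusAt` ∕ `cov_of_thm2TorusUniform` ∕ `cov_of_thm2TorusSockets`, p595412 ∕ p596003)

Cell `ym3-torus` ∕ width seat `ym-ust-19200-w1` (gen 2; OWNER ym3-torus-plan g25 RE-POINT 02:04:36Z (0)).  YM₃ on T³ is ladder rung R3, not the Clay problem.

WHY.  RULING g25-№1 §A booked the interiority sentence INTERIOR-AT-R of route (β)∕(β′) (every closed-fibre minimiser at a fixed radius `R ≤ R₁` lies in `𝔘_k(R)`;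
the `hIR` of `Prop7ClosedFibreHalving.existenceMinimalOrbit_of_prop8_of_interiorAtR`) as a COROLLARY of the (α)-core; w4's `Prop7ClosedFibreInteriorOfRouteAlpha`
proves `hIR ⇐ landed_prop8 ∧ C-min ∧ COV`; the w1 files hang COV on the tree's [6]-Theorem-2 interfaces.  This file composes the two, so that the (β′) entry, the
(α) entry and the COV socket provably meet at the SAME named literature inputs: Prop. 8 (landed modulo H), C-min (N06(d = 3), (S2)+(S3)) and Theorem 2 on the
torus at `SU(2)` (lit-balaban t2s-1).

WHAT IS PROVED (sorry-free, no definition).  **`interiorAtR_of_prop8_Cmin_thm2TorusAt`** (`hIR ⇐ landed_prop8 ∧ (∀ L>1 ∀ B₃>4, C-min) ∧ (∀ L>1, ∃ B₁ c₁ > 0, ∀ members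
∃ β₀ B₂ len, Thm2TorusAt (F.P K).L (K−n) (sitesPerDir 0) η β₀ B₁ B₂ c₁ len SU(2) True)`); **`interiorAtR_of_prop8_Cmin_thm2TorusUniform`** (Theorem 2 in print's quantifier
order at every `L > 1`); **`interiorAtR_of_prop8_Cmin_thm2TorusSockets`** (Theorem 2's socket bundle `B8Thm2TorusSupplier.Thm2TorusSockets` at the T³ members of every
block size `L ≥ 2`, constants `β₀ B₀ B₀β B₄ c_u B₁ c₀ len` per `L` with `15·L·B₀ ≥ 2`, `B₁ > 1500·L·B₀`).

HONEST SCOPE.  COMPOSITIONS only; Prop. 8 (`hP8`), C-min (`hCall`) and Theorem 2 ∕ its sockets (`hT` ∕ `hU` ∕ `hS`) are displayed HYPOTHESES, none proved here or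
(for C-min, Thm 2 at a curved background, the sockets) anywhere in the tree; no uniqueness is used; NOT a proof of INTERIOR-AT-R, of EX, of the crux or of anything
about the gap.  Count-neutral helper toward stmt-QuantumFields-19200 (`--supports`); nothing continuum ∕ OS ∕ mass-gap ∕ Clay.

References: T. Bałaban, CMP **102** (1985) 277–309 [Balaban1985Variational] ((6)–(8) pp.278–279, (14) p.280, Props 4–6 pp.291–295, (116) p.295, Prop. 7 p.299, Prop. 8
p.304); CMP **99** (1985) 75–102 [Balaban1985RegularSpaces] (Thm 2 p.83, p.77 («Ω_j = T_η»), Prop. 5 p.94, (1.42) p.83, (1.59) p.86).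
-/

set_option autoImplicit false

noncomputable section

open scoped Matrix.Norms.L2Operator

namespace Summit.QuantumFields.YangMills.Theorems.Prop7InteriorOfCminThm2

open Set
open Literature.MathematicalPhysics.QuantumFieldTheory.Balaban1983to89
open Literature.MathematicalPhysics.QuantumFieldTheory.Balaban1983to89.T3ContinuumYM3Torus
open Literature.MathematicalPhysics.QuantumFieldTheory.Balaban1983to89.T3UnitLawDensityEML (ℰp)
open Literature.MathematicalPhysics.QuantumFieldTheory.Balaban1983to89.T3DescentFibreTower
open Literature.MathematicalPhysics.QuantumFieldTheory.Balaban1983to89.T3ConstrainedMinimiser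
open Literature.MathematicalPhysics.QuantumFieldTheory.Balaban1983to89.T3TiltDescent
open Literature.MathematicalPhysics.QuantumFieldTheory.Balaban1983to89.T3PrintedRegularMinimiser
open Literature.MathematicalPhysics.QuantumFieldTheory.Balaban1983to89.T3RegularMinimiser (regThreshold)
open Literature.MathematicalPhysics.QuantumFieldTheory.Balaban1983to89.T3Thm1Carrier
open Literature.MathematicalPhysics.QuantumFieldTheory.Balaban1983to89.T3SectALandauChart
open Literature.MathematicalPhysics.QuantumFieldTheory.Balaban1983to89.B10Eq27TorusAxialLog (toUField unitsField)
open Literature.MathematicalPhysics.QuantumFieldTheory.Balaban1983to89.B10Eq68TorusRegularity (covDivT)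
open B7Prop1Explicit renaming Site → LSite
open B7Prop1Explicit (e)
open B7Prop2SpecialUnitary (specialUnitaryUnits)
open B8Ineq132 (InAk)
open B8Eq119TwistedAxial (InAx)
open B8Eq133Hypotheses (Hyp135)
open B12Ineq417Flat (shiftCfg)
open B8Thm4TorusAt (torusLam)
open B8Thm2TorusAt (Thm2TorusAt Thm2TorusUniform)
open B8Thm2TorusSupplier (Thm2TorusSockets)
open Summit.QuantumFields.YangMills.Theorems.Prop7TPrint
open Summit.QuantumFields.YangMills.Theorems.Prop7SPrint
open Summit.QuantumFields.YangMills.Theorems.Prop7ClosedFibreInteriorOfRouteAlpha (interiorAtR_of_prop8_Cmin_cov)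
open Summit.QuantumFields.YangMills.Theorems.Prop7CovOfThm2 (cov_of_thm2TorusAt cov_of_thm2TorusUniform)
open Summit.QuantumFields.YangMills.Theorems.Prop7CovOfThm2Sockets (cov_of_thm2TorusSockets)

/-- **INTERIOR-AT-R ⇐ PROP. 8 ∧ C-min ∧ `Thm2TorusAt … (specialUnitaryUnits (Fin 2)) (fun _ => True)` AT THE T³ MEMBERS** (constants `B₁, c₁ > 0` chosen before the members
of each block size `L > 1`; Hölder data `β₀, B₂, len` per member): w4's `interiorAtR_of_prop8_Cmin_cov` with its COV hypothesis supplied, at every `(L, B₃)`, by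
`Prop7CovOfThm2.cov_of_thm2TorusAt`.  The conclusion is the sentence `hIR` VERBATIM.  A composition; all three inputs remain hypotheses.
[cite: Balaban1985Variational, Prop. 8 p.304, Prop. 7 p.299, Props 4–6 pp.291–295; Balaban1985RegularSpaces, Thm 2 p.83, p.77 («Ω_j = T_η for j = 0,1,…,l, l ≤ k»)] -/
theorem interiorAtR_of_prop8_Cmin_thm2TorusAt
    (hP8 : ∀ L : ℕ, 1 < L → ∃ B₃ : ℝ, 4 < B₃ ∧ B11.Prop8Printed B₃ (T3Thm1Carrier.famX L))
    (hCall : ∀ L : ℕ, 1 < L → ∀ B₃ : ℝ, 4 < B₃ →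
      ∃ B₀ a₄ : ℝ, 0 < B₀ ∧ 0 < a₄ ∧ ∀ (i : Idx L) (ε₁ ε₄ : ℝ), 0 < ε₁ → ε₄ ≤ a₄ → 2 * B₀ * (L : ℝ) ^ 3 * B₃ * ε₁ ≤ ε₄ →
        ∀ (V : GaugeField (i.1.1.P i.1.2.1) 0 (Matrix.specialUnitaryGroup (Fin 2) ℂ)) (U₀ : GaugeField (i.1.1.P i.1.2.2) 0 (Matrix.specialUnitaryGroup (Fin 2) ℂ)),
          PlaqSmall ε₁ V → RegPr i.1.1 i.1.2.1 i.1.2.2 ((L : ℝ) ^ 3 * B₃ * ε₁) U₀ → CloseAvg i.1.1 i.1.2.1 i.1.2.2 i.2.2.le ((L : ℝ) ^ 3 * ε₁) V U₀ →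
          ∃ X : PBond (i.1.1.P i.1.2.2) 0 → Matrix (Fin 2) (Fin 2) ℂ,
            nMax19 i.1.1 i.1.2.1 i.1.2.2 U₀ X < 3 * B₀ * (L : ℝ) ^ 3 * B₃ * ε₁ ∧ (∀ b : PBond (i.1.1.P i.1.2.2) 0, (X b).IsHermitian ∧ Matrix.trace (X b) = 0) ∧
            AvgCondPrint i.1.1 i.1.2.1 i.1.2.2 i.2.2.le V U₀ X ∧ IsLandauPrint i.1.1 i.1.2.1 i.1.2.2 U₀ X ∧
            ∀ X' : PBond (i.1.1.P i.1.2.2) 0 → Matrix (Fin 2) (Fin 2) ℂ, nMax19 i.1.1 i.1.2.1 i.1.2.2 U₀ X' < ε₄ → (∀ b : PBond (i.1.1.P i.1.2.2) 0, (X' b).IsHermitian ∧ Matrix.trace (X' b) = 0) →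
              AvgCondPrint i.1.1 i.1.2.1 i.1.2.2 i.2.2.le V U₀ X' → IsLandauPrint i.1.1 i.1.2.1 i.1.2.2 U₀ X' →
                wilsonAction4 (emb15 U₀ (expHermField X)) ≤ wilsonAction4 (emb15 U₀ (expHermField X')))
    (hT : ∀ L : ℕ, 1 < L → ∃ B₁ c₁ : ℝ, 0 < B₁ ∧ 0 < c₁ ∧ ∀ (F : T3Family), F.L = L → ∀ (n K : ℕ), n < K →
      ∃ (β₀ B₂ : ℝ) (len : LSite (F.P K).d → ℝ),
        Thm2TorusAt (F.P K).L (K - n) ((((F.P K).sitesPerDir 0 : ℕ) : ℤ)) (eta F n K) β₀ B₁ B₂ c₁ len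
          (specialUnitaryUnits (Fin 2)) (fun _ => True)) :
    ∀ L : ℕ, 1 < L → ∀ B₃ : ℝ, 4 < B₃ → ∃ R₁ : ℝ, 0 < R₁ ∧ ∀ R : ℝ, 0 < R → R ≤ R₁ → ∃ a₁' : ℝ, 0 < a₁' ∧
      ∀ F : T3Family, F.L = L → ∀ (n K : ℕ) (hnK : n < K) (ε₁ : ℝ), 0 < ε₁ → ε₁ ≤ a₁' →
        ∀ V : GaugeField (F.P n) 0 (Matrix.specialUnitaryGroup (Fin 2) ℂ), PlaqSmall ε₁ V →
          ∀ U₀ : GaugeField (F.P K) 0 (Matrix.specialUnitaryGroup (Fin 2) ℂ), RegPr F n K ((L : ℝ) ^ 3 * B₃ * ε₁) U₀ →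
            U₀ ∈ fibre F ℰp n K hnK.le V →
            ∀ Ū : GaugeField (F.P K) 0 (Matrix.specialUnitaryGroup (Fin 2) ℂ),
              Ū ∈ {U : GaugeField (F.P K) 0 (Matrix.specialUnitaryGroup (Fin 2) ℂ) | ∀ p : Plaq (F.P K) 0,
                  GaugeGroup.dist1 (GaugeField.plaqHol U p) ≤ regThreshold F n K R} ∩ descendTo F ℰp n K hnK.le ⁻¹' {V} ∩
                {U | ∀ b : PBond (F.P K) 0, ‖covDivT 1 (unitsField (toUField U)) b.dir b.src‖ ≤ R * ((F.L : ℝ)⁻¹) ^ (3 * (K - n))} →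
              IsMinOn (fun W : GaugeField (F.P K) 0 (Matrix.specialUnitaryGroup (Fin 2) ℂ) => wilsonAction4 W)
                ({U : GaugeField (F.P K) 0 (Matrix.specialUnitaryGroup (Fin 2) ℂ) | ∀ p : Plaq (F.P K) 0,
                  GaugeGroup.dist1 (GaugeField.plaqHol U p) ≤ regThreshold F n K R} ∩ descendTo F ℰp n K hnK.le ⁻¹' {V} ∩
                {U | ∀ b : PBond (F.P K) 0, ‖covDivT 1 (unitsField (toUField U)) b.dir b.src‖ ≤ R * ((F.L : ℝ)⁻¹) ^ (3 * (K - n))}) Ū →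
              RegPr F n K R Ū :=
  interiorAtR_of_prop8_Cmin_cov hP8 hCall fun L hL B₃ hB₃ => by
    obtain ⟨B₁, c₁, hB₁, hc₁, h⟩ := hT L hL
    exact cov_of_thm2TorusAt (by linarith) hB₁ hc₁ h

/-- **INTERIOR-AT-R ⇐ PROP. 8 ∧ C-min ∧ PRINT'S UNIFORM THEOREM 2 `Thm2TorusUniform L β₀ len SU(2) True` AT EVERY BLOCK SIZE `L > 1`** (d = 3; Hölder data `β₀, len`
per `L`): w4's `interiorAtR_of_prop8_Cmin_cov` ∘ `Prop7CovOfThm2.cov_of_thm2TorusUniform`.  A composition; all three inputs remain hypotheses.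
[cite: Balaban1985Variational, Prop. 8 p.304, Prop. 7 p.299; Balaban1985RegularSpaces, Thm 2 p.83, p.83 (sentence after (1.39))] -/
theorem interiorAtR_of_prop8_Cmin_thm2TorusUniform
    (hP8 : ∀ L : ℕ, 1 < L → ∃ B₃ : ℝ, 4 < B₃ ∧ B11.Prop8Printed B₃ (T3Thm1Carrier.famX L))
    (hCall : ∀ L : ℕ, 1 < L → ∀ B₃ : ℝ, 4 < B₃ →
      ∃ B₀ a₄ : ℝ, 0 < B₀ ∧ 0 < a₄ ∧ ∀ (i : Idx L) (ε₁ ε₄ : ℝ), 0 < ε₁ → ε₄ ≤ a₄ → 2 * B₀ * (L : ℝ) ^ 3 * B₃ * ε₁ ≤ ε₄ →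
        ∀ (V : GaugeField (i.1.1.P i.1.2.1) 0 (Matrix.specialUnitaryGroup (Fin 2) ℂ)) (U₀ : GaugeField (i.1.1.P i.1.2.2) 0 (Matrix.specialUnitaryGroup (Fin 2) ℂ)),
          PlaqSmall ε₁ V → RegPr i.1.1 i.1.2.1 i.1.2.2 ((L : ℝ) ^ 3 * B₃ * ε₁) U₀ → CloseAvg i.1.1 i.1.2.1 i.1.2.2 i.2.2.le ((L : ℝ) ^ 3 * ε₁) V U₀ →
          ∃ X : PBond (i.1.1.P i.1.2.2) 0 → Matrix (Fin 2) (Fin 2) ℂ,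
            nMax19 i.1.1 i.1.2.1 i.1.2.2 U₀ X < 3 * B₀ * (L : ℝ) ^ 3 * B₃ * ε₁ ∧ (∀ b : PBond (i.1.1.P i.1.2.2) 0, (X b).IsHermitian ∧ Matrix.trace (X b) = 0) ∧
            AvgCondPrint i.1.1 i.1.2.1 i.1.2.2 i.2.2.le V U₀ X ∧ IsLandauPrint i.1.1 i.1.2.1 i.1.2.2 U₀ X ∧
            ∀ X' : PBond (i.1.1.P i.1.2.2) 0 → Matrix (Fin 2) (Fin 2) ℂ, nMax19 i.1.1 i.1.2.1 i.1.2.2 U₀ X' < ε₄ → (∀ b : PBond (i.1.1.P i.1.2.2) 0, (X' b).IsHermitian ∧ Matrix.trace (X' b) = 0) →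
              AvgCondPrint i.1.1 i.1.2.1 i.1.2.2 i.2.2.le V U₀ X' → IsLandauPrint i.1.1 i.1.2.1 i.1.2.2 U₀ X' →
                wilsonAction4 (emb15 U₀ (expHermField X)) ≤ wilsonAction4 (emb15 U₀ (expHermField X')))
    (hU : ∀ L : ℕ, 1 < L → ∃ (β₀ : ℝ) (len : LSite 3 → ℝ),
      Thm2TorusUniform (𝔸 := Matrix (Fin 2) (Fin 2) ℂ) L β₀ len (specialUnitaryUnits (Fin 2)) (fun _ _ _ _ => True)) :
    ∀ L : ℕ, 1 < L → ∀ B₃ : ℝ, 4 < B₃ → ∃ R₁ : ℝ, 0 < R₁ ∧ ∀ R : ℝ, 0 < R → R ≤ R₁ → ∃ a₁' : ℝ, 0 < a₁' ∧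
      ∀ F : T3Family, F.L = L → ∀ (n K : ℕ) (hnK : n < K) (ε₁ : ℝ), 0 < ε₁ → ε₁ ≤ a₁' →
        ∀ V : GaugeField (F.P n) 0 (Matrix.specialUnitaryGroup (Fin 2) ℂ), PlaqSmall ε₁ V →
          ∀ U₀ : GaugeField (F.P K) 0 (Matrix.specialUnitaryGroup (Fin 2) ℂ), RegPr F n K ((L : ℝ) ^ 3 * B₃ * ε₁) U₀ →
            U₀ ∈ fibre F ℰp n K hnK.le V →
            ∀ Ū : GaugeField (F.P K) 0 (Matrix.specialUnitaryGroup (Fin 2) ℂ),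
              Ū ∈ {U : GaugeField (F.P K) 0 (Matrix.specialUnitaryGroup (Fin 2) ℂ) | ∀ p : Plaq (F.P K) 0,
                  GaugeGroup.dist1 (GaugeField.plaqHol U p) ≤ regThreshold F n K R} ∩ descendTo F ℰp n K hnK.le ⁻¹' {V} ∩
                {U | ∀ b : PBond (F.P K) 0, ‖covDivT 1 (unitsField (toUField U)) b.dir b.src‖ ≤ R * ((F.L : ℝ)⁻¹) ^ (3 * (K - n))} →
              IsMinOn (fun W : GaugeField (F.P K) 0 (Matrix.specialUnitaryGroup (Fin 2) ℂ) => wilsonAction4 W)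
                ({U : GaugeField (F.P K) 0 (Matrix.specialUnitaryGroup (Fin 2) ℂ) | ∀ p : Plaq (F.P K) 0,
                  GaugeGroup.dist1 (GaugeField.plaqHol U p) ≤ regThreshold F n K R} ∩ descendTo F ℰp n K hnK.le ⁻¹' {V} ∩
                {U | ∀ b : PBond (F.P K) 0, ‖covDivT 1 (unitsField (toUField U)) b.dir b.src‖ ≤ R * ((F.L : ℝ)⁻¹) ^ (3 * (K - n))}) Ū →
              RegPr F n K R Ū :=
  interiorAtR_of_prop8_Cmin_cov hP8 hCall fun L hL B₃ hB₃ => by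
    obtain ⟨β₀, len, h⟩ := hU L hL
    exact cov_of_thm2TorusUniform (by linarith) h

/-- **INTERIOR-AT-R ⇐ PROP. 8 ∧ C-min ∧ THE SOCKET BUNDLE OF THEOREM 2 ON THE TORUS AT THE T³ MEMBERS OF EVERY BLOCK SIZE `L ≥ 2`** (`d = 3`, `SU(2)`; per `L` the socket
constants `β₀ B₀ B₀β B₄ c_u B₁ c₀ len` with `15·L·B₀ ≥ 2`, `B₀β, B₄ ≥ 0`, `c_u, c₀ > 0`, `B₁ > 1500·L·B₀`, and the sockets `B8Thm2TorusSupplier.Thm2TorusSockets` — Prop. 5, (1.42),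
(1.59) — for every admissible periodic `SU(2)` pair at every member): w4's `interiorAtR_of_prop8_Cmin_cov` ∘ `Prop7CovOfThm2Sockets.cov_of_thm2TorusSockets`.  A composition;
all inputs remain hypotheses. [cite: Balaban1985Variational, Prop. 8 p.304, Prop. 7 p.299; Balaban1985RegularSpaces, Thm 2 p.83, Prop. 5 p.94, (1.42) p.83, (1.59) p.86] -/
theorem interiorAtR_of_prop8_Cmin_thm2TorusSockets
    (hP8 : ∀ L : ℕ, 1 < L → ∃ B₃ : ℝ, 4 < B₃ ∧ B11.Prop8Printed B₃ (T3Thm1Carrier.famX L))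
    (hCall : ∀ L : ℕ, 1 < L → ∀ B₃ : ℝ, 4 < B₃ →
      ∃ B₀ a₄ : ℝ, 0 < B₀ ∧ 0 < a₄ ∧ ∀ (i : Idx L) (ε₁ ε₄ : ℝ), 0 < ε₁ → ε₄ ≤ a₄ → 2 * B₀ * (L : ℝ) ^ 3 * B₃ * ε₁ ≤ ε₄ →
        ∀ (V : GaugeField (i.1.1.P i.1.2.1) 0 (Matrix.specialUnitaryGroup (Fin 2) ℂ)) (U₀ : GaugeField (i.1.1.P i.1.2.2) 0 (Matrix.specialUnitaryGroup (Fin 2) ℂ)),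
          PlaqSmall ε₁ V → RegPr i.1.1 i.1.2.1 i.1.2.2 ((L : ℝ) ^ 3 * B₃ * ε₁) U₀ → CloseAvg i.1.1 i.1.2.1 i.1.2.2 i.2.2.le ((L : ℝ) ^ 3 * ε₁) V U₀ →
          ∃ X : PBond (i.1.1.P i.1.2.2) 0 → Matrix (Fin 2) (Fin 2) ℂ,
            nMax19 i.1.1 i.1.2.1 i.1.2.2 U₀ X < 3 * B₀ * (L : ℝ) ^ 3 * B₃ * ε₁ ∧ (∀ b : PBond (i.1.1.P i.1.2.2) 0, (X b).IsHermitian ∧ Matrix.trace (X b) = 0) ∧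
            AvgCondPrint i.1.1 i.1.2.1 i.1.2.2 i.2.2.le V U₀ X ∧ IsLandauPrint i.1.1 i.1.2.1 i.1.2.2 U₀ X ∧
            ∀ X' : PBond (i.1.1.P i.1.2.2) 0 → Matrix (Fin 2) (Fin 2) ℂ, nMax19 i.1.1 i.1.2.1 i.1.2.2 U₀ X' < ε₄ → (∀ b : PBond (i.1.1.P i.1.2.2) 0, (X' b).IsHermitian ∧ Matrix.trace (X' b) = 0) →
              AvgCondPrint i.1.1 i.1.2.1 i.1.2.2 i.2.2.le V U₀ X' → IsLandauPrint i.1.1 i.1.2.1 i.1.2.2 U₀ X' →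
                wilsonAction4 (emb15 U₀ (expHermField X)) ≤ wilsonAction4 (emb15 U₀ (expHermField X')))
    (hS : ∀ L : ℕ, 1 < L → ∃ (β₀ B₀ B₀β B₄ cu B₁ c₀ : ℝ) (len : LSite 3 → ℝ),
      2 ≤ 15 * (L : ℝ) * B₀ ∧ 0 ≤ B₀β ∧ 0 ≤ B₄ ∧ 0 < cu ∧ 1500 * (L : ℝ) * B₀ < B₁ ∧ 0 < c₀ ∧
      ∀ (F : T3Family), F.L = L → ∀ (n K : ℕ), n < K → ∀ ⦃α₀ α₁ : ℝ⦄, 0 < α₀ → 0 < α₁ → α₀ + α₁ ≤ c₀ →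
        ∀ U₀ U' : LSite 3 → Fin 3 → (Matrix (Fin 2) (Fin 2) ℂ)ˣ,
        (∀ x κ, U₀ x κ ∈ specialUnitaryUnits (Fin 2)) → (∀ x κ, U' x κ ∈ specialUnitaryUnits (Fin 2)) →
        (∀ i : Fin 3, shiftCfg (((((F.P K).sitesPerDir 0 : ℕ) : ℤ)) • e i) U₀ = U₀) →
        (∀ i : Fin 3, shiftCfg (((((F.P K).sitesPerDir 0 : ℕ) : ℤ)) • e i) U' = U') →
        InAk L (K - n) (eta F n K) α₀ (fun _ => (Set.univ : Set (LSite 3))) U₀ →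
        InAk L (K - n) (eta F n K) α₀ (fun _ => (Set.univ : Set (LSite 3))) (U' * U₀) →
        InAx L (K - n) (torusLam (K - n)) U₀ (U' * U₀) → Hyp135 L (K - n) (torusLam (K - n)) α₁ U₀ U' →
        Thm2TorusSockets L (K - n) ((((F.P K).sitesPerDir 0 : ℕ) : ℤ)) (eta F n K) β₀ B₀ B₀β B₄ cu B₁ len
          (specialUnitaryUnits (Fin 2)) α₀ α₁ U₀ U') :
    ∀ L : ℕ, 1 < L → ∀ B₃ : ℝ, 4 < B₃ → ∃ R₁ : ℝ, 0 < R₁ ∧ ∀ R : ℝ, 0 < R → R ≤ R₁ → ∃ a₁' : ℝ, 0 < a₁' ∧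
      ∀ F : T3Family, F.L = L → ∀ (n K : ℕ) (hnK : n < K) (ε₁ : ℝ), 0 < ε₁ → ε₁ ≤ a₁' →
        ∀ V : GaugeField (F.P n) 0 (Matrix.specialUnitaryGroup (Fin 2) ℂ), PlaqSmall ε₁ V →
          ∀ U₀ : GaugeField (F.P K) 0 (Matrix.specialUnitaryGroup (Fin 2) ℂ), RegPr F n K ((L : ℝ) ^ 3 * B₃ * ε₁) U₀ →
            U₀ ∈ fibre F ℰp n K hnK.le V →
            ∀ Ū : GaugeField (F.P K) 0 (Matrix.specialUnitaryGroup (Fin 2) ℂ),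
              Ū ∈ {U : GaugeField (F.P K) 0 (Matrix.specialUnitaryGroup (Fin 2) ℂ) | ∀ p : Plaq (F.P K) 0,
                  GaugeGroup.dist1 (GaugeField.plaqHol U p) ≤ regThreshold F n K R} ∩ descendTo F ℰp n K hnK.le ⁻¹' {V} ∩
                {U | ∀ b : PBond (F.P K) 0, ‖covDivT 1 (unitsField (toUField U)) b.dir b.src‖ ≤ R * ((F.L : ℝ)⁻¹) ^ (3 * (K - n))} →
              IsMinOn (fun W : GaugeField (F.P K) 0 (Matrix.specialUnitaryGroup (Fin 2) ℂ) => wilsonAction4 W)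
                ({U : GaugeField (F.P K) 0 (Matrix.specialUnitaryGroup (Fin 2) ℂ) | ∀ p : Plaq (F.P K) 0,
                  GaugeGroup.dist1 (GaugeField.plaqHol U p) ≤ regThreshold F n K R} ∩ descendTo F ℰp n K hnK.le ⁻¹' {V} ∩
                {U | ∀ b : PBond (F.P K) 0, ‖covDivT 1 (unitsField (toUField U)) b.dir b.src‖ ≤ R * ((F.L : ℝ)⁻¹) ^ (3 * (K - n))}) Ū →
              RegPr F n K R Ū :=
  interiorAtR_of_prop8_Cmin_cov hP8 hCall fun L hL B₃ hB₃ => by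
    obtain ⟨β₀, B₀, B₀β, B₄, cu, B₁, c₀, len, hB₀, hB₀β, hB₄, hcu, hB₁, hc₀, h⟩ := hS L hL
    exact cov_of_thm2TorusSockets (Nat.succ_le_of_lt hL) (by linarith) hB₀ hB₀β hB₄ hcu hB₁ hc₀ h

end Summit.QuantumFields.YangMills.Theorems.Prop7InteriorOfCminThm2

end
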